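import Summits.ABC.IUTFork.DAGC312zg
import Summits.ABC.IUTFork.DAGC312zd
import Summits.ABC.IUTFork.DAGC312k
import Summits.ABC.IUTFork.Conditional.AbcOfSHvolRefutation
import Summits.ABC.IUTFork.Conditional.AbcOfSGenuineKCanonicalHex
import Summits.ABC.IUTFork.Conditional.AbcOfSGenuineKWindowThetaSzpiroBadAll
import HarnessLib

/-!
# Kernel DAG index — layer C312, part zh (Δ20): APEX STATUS CENSUS v12 — the apex certificates of record and the apex binders refuted
# AS TYPED during 2026-08-26, BY NAME (one FQN for letter K2 of D-0079)

index Δ20 · abc-iut-c312-2 gen 5 (filer) per HOME/plan/KERNEL-DAG-SPEC.md v1.3 §4 (3) (apex duty of the index) and the one-name census pattern of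
`DAG.cor312_kernel_census_v10/v11` (DAGC312ze/zf). APPEND-ONLY; PROOF-ONLY (no `def`, no new `Prop`, no instance). THIS FILE PROVES NOTHING NEW: it
conjoins the STATEMENTS of landed theorems (`PartC312k.StatementOf @thm`, the index's landed helper) and proves the conjunction by the tuple of those theorems.

WHAT `apex_status_v12` RECORDS (each conjunct is a theorem ALREADY in the tree, cited by name; ns `Summit.ABC.IUTFork.` omitted):
(a) `Conditional.not_hreg_v4` (abc-iut-s2-p5, p453135) — the blanket CONE binder `hreg` carried verbatim by the branch-C certificates v4 … v11
    (and by `Conditional.abc_of_cor312Statement_genuineM`, the letter-K apex named by director-abc 13:10:04Z) is FALSE AS TYPED: an explicit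
    admissible degree-2 family violates the sharp datum-free necessity inequality for all large `k`; hence every certificate of the shape
    «… → hreg → ABC» is a composition record whose CONE antecedent is unsatisfiable as typed (RULING C-R32/C-R34: repaired by cutting to the
    Szpiro-bad admissible points, (c));
(b) `Conditional.not_hvol_v3` (same file) — the volume-form CONE binder `hvol` of `abc_of_S_v3` is false as typed likewise;
(c) `Conditional.abc_of_SH_v10K_window_szpiroBadAll` (abc-iut-s2-p2, p453137) — the CERTIFICATE OF RECORD after (a) (plan C-R34 (1)): `ABC` from
    three per-datum binders consumed ONLY at Szpiro-bad admissible `(P, l)`: `hSHwBad` (hull-level (xi-f) clause off the depth locus, in the window),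
    `hNumBad` (the number-level Corollary there), `hregBad` (the hull estimate with `B_III(P,l)` off the slot-constant regime) — explicit 3;
(d) `Conditional.not_hSH_v7K` (abc-iut-C-cert-2 over C-cert-1's HEX-KERNEL `not_hSH_v6K`, p443604/p442796) — the UNWINDOWED S_H binder of the
    K-line (v6K/v7K) is false as typed at an explicit admissible datum (sharp reading);
(e) `DAG.N_IUTchIII_Thm3_11_inhabited` (Δ19, p453336) — the claim-form premise node [IUTchIII] Thm 3.11 AS TYPED is kernel-inhabited at real data
    (content-free container, FINDINGS v3.0 §A NB2; plan C-R34 (2): booked «discharged-at-reading», separate class);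
(f) `DAG.summit_real_of_statement'` (Δ17′, p429125) — the index's data-existential apex: `ABC` ⟸ per admissible `(η, P, l)` real initial Θ-data +
    provenance + matching numerics + `Nonempty ProofData` + [IUTchIII] Cor 3.12 AS TYPED at the verbatim setting (kernel_hyps = 1 bundle; NOTE:
    after (a) the satisfiability of its `ProofData`/volume-side at deep admissible data is exactly what letters W/H study — the apex is a
    composition record, not a claim that its antecedent is inhabited).
K2 READING (for abc-iut-dag's letter K): apex of record = (c), explicit per-datum binders 3 (hSHwBad · hNumBad · hregBad), none of them refuted
as typed at this hour; refuted-as-typed apex binders on EARLIER apexes: `hreg`/`hvol` (a)(b), un-windowed `hSH` (d). Typed premise node (e):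
inhabited, content-free. No number here is a verdict on print.

HONEST FRAMING: statements about OUR typed objects; «refuted as typed» ≠ «refuted in print»; «inhabited as typed» ≠ «true in print»; nothing here
asserts that abc is proved or refuted or takes a side on [IUTchIII] Cor. 3.12 / [IUTchIV] Thm. 1.10 or on any author (Mochizuki / Scholze–Stix /
Joshi / Dupuy–Hilado). typed ≠ discharged; indexed ≠ endorsed. Co-import: F1-neutral as far as the sentinel's 11:24Z sides file knows; side B of
F-w5d064-1 via DAGC312zg. [claim: Mochizuki2012, status: disputed]
[cite: Mochizuki2012, IUTchIII Cor. 3.12 p. 173–174; IUTchIV Thm. 1.10 pp. 22–31, Cor. 2.2 pp. 43–46]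
-/

noncomputable section

namespace Summit.ABC.IUTFork.DAG

open PartC312k  -- `StatementOf h` := the statement of which `h` is the proof (landed in DAGC312k; re-types nothing, no new definition here)

/-- **APEX STATUS CENSUS v12 (Δ20; one FQN for letter K2).** The conjunction, BY NAME, of: (a) `Conditional.not_hreg_v4` — the blanket CONE
binder `hreg` of the certificates v4…v11 / `abc_of_cor312Statement_genuineM` is FALSE AS TYPED; (b) `Conditional.not_hvol_v3`; (c) the certificate
of record `Conditional.abc_of_SH_v10K_window_szpiroBadAll` (explicit 3: hSHwBad · hNumBad · hregBad, consumed only at Szpiro-bad admissible data);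
(d) `Conditional.not_hSH_v7K` — the un-windowed S_H binder is false as typed (HEX kernel); (e) `DAG.N_IUTchIII_Thm3_11_inhabited` — the typed
premise node is kernel-inhabited at real data (content-free container); (f) `DAG.summit_real_of_statement'` — the index's data-existential apex
(composition record). Proof = the tuple of those theorems; proves nothing new; «refuted/inhabited as typed» ≠ «in print»; no side taken.
[claim: Mochizuki2012, status: disputed] -/
theorem apex_status_v12 :
    StatementOf @Summit.ABC.IUTFork.Conditional.not_hreg_v4 ∧
    StatementOf @Summit.ABC.IUTFork.Conditional.not_hvol_v3 ∧
    StatementOf @Summit.ABC.IUTFork.Conditional.abc_of_SH_v10K_window_szpiroBadAll ∧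
    StatementOf @Summit.ABC.IUTFork.Conditional.not_hSH_v7K ∧
    StatementOf @Summit.ABC.IUTFork.DAG.N_IUTchIII_Thm3_11_inhabited ∧
    StatementOf @Summit.ABC.IUTFork.DAG.summit_real_of_statement' :=
  ⟨@Summit.ABC.IUTFork.Conditional.not_hreg_v4, @Summit.ABC.IUTFork.Conditional.not_hvol_v3,
    @Summit.ABC.IUTFork.Conditional.abc_of_SH_v10K_window_szpiroBadAll, @Summit.ABC.IUTFork.Conditional.not_hSH_v7K,
    @Summit.ABC.IUTFork.DAG.N_IUTchIII_Thm3_11_inhabited, @Summit.ABC.IUTFork.DAG.summit_real_of_statement'⟩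

end Summit.ABC.IUTFork.DAG

end
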